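import Literature.AnabelianGeometry.AbsoluteAnabelian.ArchimedeanHolPairs
import Mathlib.Analysis.Calculus.Deriv.Star
import HarnessLib

/-!
# [AbsTopIII] Def 4.1 (ii): the morphism condition of `𝒞^hol_TH` does not depend on the chart `𝒜_𝕐 ⥲ ℂ`

Mochizuki, *Topics in Absolute Anabelian Geometry III*, §4, Def 4.1 (ii) p. 102 (morphisms of
Aut-holomorphic `T`-pairs: "compatible [relative to the respective Kummer structures]") and Cor 2.3 (i)
p. 53 ("precisely two co-holomorphicizations", the holomorphic and the anti-holomorphic one) of the
author's kurims manuscript (lit key `paper:url-5493eb38cbb7`; bib key `MochizukiAbsTopIII2015`).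
PROOF-ONLY companion (abc-iut cell, row C45-M0, seat abc-iut-L4-t10) of `ArchimedeanHolPairs.lean`,
substantiating the sentence of its docstring: in `HolTHPair.Hom` the holomorphy of `φ_M` is required in
the Kummer charts composed with EVERY isomorphism of topological fields `e : 𝒜_𝕐 ⥲ ℂ`, "both charts change
together, so the choice is immaterial".  Indeed any two such `e`, `e'` differ by a continuous ring
automorphism of `ℂ`, i.e. by the identity or complex conjugation
(`Complex.ringHom_eq_id_or_conj_of_continuous`), and conjugating BOTH charts preserves "holomorphic with
nowhere-vanishing derivative" (`conj ∘ g ∘ conj` is holomorphic with derivative `conj g'`, Mathlib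
`HasDerivAt.conj_conj`) — `IsHolLocIso.conj`.  Hence the `∀ e` condition follows from its instance at
any single bicontinuous `e₀` (`HolTHPair.hol_of_one_chart`), so a morphism of `𝒞^hol_TH` may be built
from one chart (`HolTHPair.Hom.hol_iff_one_chart`).  Refereed pre-IUT material + classical complex
analysis; nothing here bears on [IUTchIII] Cor. 3.12.
-/

namespace Literature.AnabelianGeometry.AbsoluteAnabelian

open _root_.CategoryTheory _root_.Topology
open scoped ComplexConjugate

universe u

/-! ### Conjugating both charts -/

section Conj

variable {k₁ k₂ : Type u}

/-- **Conjugating both charts preserves holomorphic local isomorphisms**: if `φ` is a holomorphic local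
isomorphism in the charts `u₁`, `u₂`, it is one in the charts `conj ∘ u₁`, `conj ∘ u₂` (its coordinate
expression becomes `conj ∘ g ∘ conj`, holomorphic with derivative `conj g' ≠ 0`) — the anti-holomorphic
co-holomorphicization on both sides gives the same class of compatible maps (Cor 2.3 (i)).
[cite: MochizukiAbsTopIII2015, Corollary 2.3 (i) p.53] -/
theorem IsHolLocIso.conj {u₁ : k₁ → ℂ} (hu₁ : Function.Injective u₁) {u₂ : k₂ → ℂ} {S : Set k₁}
    (hS : IsOpen (u₁ '' S)) {φ : S → k₂} (h : IsHolLocIso u₁ u₂ S φ) :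
    IsHolLocIso (fun x => conj (u₁ x)) (fun y => conj (u₂ y)) S φ := by
  have hinj : Function.Injective (fun x => conj (u₁ x)) :=
    fun a b hab => hu₁ ((starRingEnd ℂ).injective hab)
  have himage : (fun x => conj (u₁ x)) '' S = conj '' (u₁ '' S) := by
    rw [← Set.image_image]
  have hopen : IsOpen ((fun x => conj (u₁ x)) '' S) := by
    rw [himage]
    exact Complex.conjCLE.toHomeomorph.isOpenMap _ hS
  set g := coordRep u₁ u₂ S φ with hg
  refine IsHolLocIso.of_eq hinj hopen (conj ∘ g ∘ conj) ?_ ?_ ?_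
  · intro z hz
    rw [himage] at hz
    obtain ⟨w, hw, rfl⟩ := hz
    have hd : DifferentiableAt ℂ g w := h.1.differentiableAt (hS.mem_nhds hw)
    exact hd.conj_conj.differentiableWithinAt
  · intro z hz
    rw [himage] at hz
    obtain ⟨w, hw, rfl⟩ := hz
    have hd : DifferentiableAt ℂ g w := h.1.differentiableAt (hS.mem_nhds hw)
    rw [hd.hasDerivAt.conj_conj.deriv]
    exact (map_ne_zero_iff _ (starRingEnd ℂ).injective).mpr (h.2 w hw)
  · intro x
    change conj (u₂ (φ x)) = conj (g (conj (conj (u₁ x))))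
    rw [Complex.conj_conj, hg, coordRep_apply hu₁ u₂ S φ x]

end Conj

/-! ### One chart suffices -/

namespace HolTHPair

variable {𝔄 : AutHolFieldFunctor.{u}}

/-- Two isomorphisms of topological fields `e₀, e : 𝒜 ⥲ ℂ` of a CAF differ by the identity or by complex
conjugation ("precisely two co-holomorphicizations", Cor 2.3 (i); Mathlib: the continuous ring
endomorphisms of `ℂ` are `id` and `conj`). [cite: MochizukiAbsTopIII2015, Corollary 2.3 (i) p.53] -/
theorem chart_eq_or_conj {A : Type u} [NormedField A] (e₀ e : A ≃+* ℂ) (he₀' : Continuous e₀.symm)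
    (he : Continuous e) :
    (∀ a, e a = e₀ a) ∨ ∀ a, e a = conj (e₀ a) := by
  have hσ : Continuous (e₀.symm.trans e).toRingHom := he.comp he₀'
  rcases Complex.ringHom_eq_id_or_conj_of_continuous hσ with h | h
  · left
    intro a
    have := congrArg (fun f : ℂ →+* ℂ => f (e₀ a)) h
    simpa using this
  · right
    intro a
    have := congrArg (fun f : ℂ →+* ℂ => f (e₀ a)) h
    simpa using this

/-- **The morphism condition of `𝒞^hol_TH` at ONE chart implies it at every chart**: if `φ_M` is a
holomorphic local isomorphism in the Kummer charts composed with one bicontinuous `e₀ : 𝒜_𝕐 ⥲ ℂ`, then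
also for every bicontinuous `e : 𝒜_𝕐 ⥲ ℂ` — `e = e₀` or `e = conj ∘ e₀`, and in the second case both
charts are conjugated (`IsHolLocIso.conj`).  This is the independence of the choice announced in the
docstring of `HolTHPair.Hom`. [cite: MochizukiAbsTopIII2015, Definition 4.1 (ii) p.102] -/
theorem hol_of_one_chart (P Q : HolTHPair 𝔄) (f : P.X ⟶ Q.X) (φ : P.carrier → Q.k)
    (e₀ : 𝔄.A Q.X ≃+* ℂ) (he₀ : Continuous e₀) (he₀' : Continuous e₀.symm)
    (h : IsHolLocIso (P.chart f e₀) (Q.chart (𝟙 Q.X) e₀) P.carrier φ)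
    (e : 𝔄.A Q.X ≃+* ℂ) (he : Continuous e) :
    IsHolLocIso (P.chart f e) (Q.chart (𝟙 Q.X) e) P.carrier φ := by
  rcases chart_eq_or_conj e₀ e he₀' he with hid | hconj
  · have h1 : P.chart f e = P.chart f e₀ := funext fun x => hid _
    have h2 : Q.chart (𝟙 Q.X) e = Q.chart (𝟙 Q.X) e₀ := funext fun y => hid _
    rw [h1, h2]
    exact h
  · have h1 : P.chart f e = fun x => conj (P.chart f e₀ x) := funext fun x => hconj _
    have h2 : Q.chart (𝟙 Q.X) e = fun y => conj (Q.chart (𝟙 Q.X) e₀ y) := funext fun y => hconj _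
    rw [h1, h2]
    exact IsHolLocIso.conj (P.chart_injective f e₀) (P.isOpen_chart_image f e₀ he₀ he₀') h

/-- **One chart suffices** (iff form): the `∀ e` holomorphy condition of `HolTHPair.Hom` is equivalent
to its instance at any single bicontinuous `e₀ : 𝒜_𝕐 ⥲ ℂ` (a CAF has one, [AbsTopIII] §0).
[cite: MochizukiAbsTopIII2015, Definition 4.1 (ii) p.102] -/
theorem hol_iff_one_chart (P Q : HolTHPair 𝔄) (f : P.X ⟶ Q.X) (φ : P.carrier → Q.k)
    (e₀ : 𝔄.A Q.X ≃+* ℂ) (he₀ : Continuous e₀) (he₀' : Continuous e₀.symm) :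
    (∀ e : 𝔄.A Q.X ≃+* ℂ, Continuous e → Continuous e.symm →
        IsHolLocIso (P.chart f e) (Q.chart (𝟙 Q.X) e) P.carrier φ) ↔
      IsHolLocIso (P.chart f e₀) (Q.chart (𝟙 Q.X) e₀) P.carrier φ :=
  ⟨fun h => h e₀ he₀ he₀', fun h e he _ => hol_of_one_chart P Q f φ e₀ he₀ he₀' h e he⟩

/-- The holomorphy field of a morphism of `𝒞^hol_TH`, read at a single chart.
[cite: MochizukiAbsTopIII2015, Definition 4.1 (ii) p.102] -/
theorem Hom.hol_one_chart {P Q : HolTHPair 𝔄} (ψ : P ⟶ Q) (e₀ : 𝔄.A Q.X ≃+* ℂ) (he₀ : Continuous e₀)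
    (he₀' : Continuous e₀.symm) :
    IsHolLocIso (P.chart ψ.base e₀) (Q.chart (𝟙 Q.X) e₀) P.carrier ψ.toFun :=
  ψ.hol e₀ he₀ he₀'

end HolTHPair

end Literature.AnabelianGeometry.AbsoluteAnabelian
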